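import Mathlib.Analysis.SpecialFunctions.Exp
import Mathlib.Analysis.SpecialFunctions.Log.Basic
import Mathlib.Analysis.SpecialFunctions.Pow.Real
import Mathlib.Analysis.SpecialFunctions.Sqrt
import Mathlib.Data.Nat.Choose.Sum
import Mathlib.Data.Nat.Log
import Literature.Computability.MetaComplexity.RobustHegedusLemma
import HarnessLib

/-!
# Cell qa-qnc0 (rung F-Q1, route RingFrame): counting a subset of the cube layer by layer

Generic bookkeeping over the Hamming layers `{0,1}ⁿ_m` of the cube (vocabulary of
`Literature/Computability/MetaComplexity/RobustHegedusLemma.lean`: `Hegedus.wt`, `Hegedus.layer`,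
`Hegedus.nzFrac`, `Hegedus.alphaOf`), used by `LowDegreeResidueAvoidance.lean` (crux β of
RingFrame) and reusable by the route's window arguments:

* `card_filter_ne_zero_eq_sum`, `card_filter_ne_zero_mod_eq_sum` — the support of a cube function
  (resp. its part in a residue class of the weight mod 3) counted layer by layer,
  `N_m = #{u ∈ layer m : P u ≠ 0} = ψ_m · C(n,m)` (`card_filter_layer_eq_nzFrac_mul`);
* `sum_choose_mul_sq` — the variance identity `Σ_m C(n,m)(2m − n)² = n·2ⁿ`, and the Chebyshev
  tail `sum_choose_filter_le_div`: layers with `(2m − n)² ≥ T` carry `≤ n·2ⁿ/T` points;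
* `choose_middle_le_exp_mul_choose` — binomial coefficients within `s` of the middle are within
  the factor `e^{8s²/n}` of the central one (`8s ≤ n`);
* small facts: a power of two in `(m, 2m]`, `2^j ≢ 0 (mod 3)`, `α(n,k) ∈ [1/4, 1/2]` in the
  middle half.

All statements are elementary ([folklore]); WHAT THIS IS NOT: nothing specific to the route.
-/

noncomputable section

namespace Summit.QuantumAdvantage.AdviceFreeQNC0

open Finset
open Literature.Computability.MetaComplexity Literature.Computability.MetaComplexity.Smolensky
open Literature.Computability.MetaComplexity.Hegedus

variable {n : ℕ}

/-! ### Counting the support layer by layer -/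

section Layers

variable {F : Type*} [Field F] [DecidableEq F]

/-- `N_m(P) = #{u ∈ {0,1}ⁿ_m : P(u) ≠ 0} ≤ C(n, m)`.
[cite: Srinivasan2023, Lemma 3.1 (the layer probabilities Pr_{a ∼ {0,1}ⁿ_m}[P(a) ≠ 0])] -/
theorem card_filter_layer_le_choose (P : CubeFn F n) (m : ℕ) :
    ((layer n m).filter fun u => P u ≠ 0).card ≤ n.choose m := by
  rw [← card_layer n m]
  exact card_filter_le _ _

/-- `N_m(P) = ψ_m · C(n, m)` for `m ≤ n`, `ψ_m = nzFrac P m`.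
[cite: Srinivasan2023, Lemma 3.1 (the layer probabilities)] -/
theorem card_filter_layer_eq_nzFrac_mul (P : CubeFn F n) {m : ℕ} (hm : m ≤ n) :
    (((layer n m).filter fun u => P u ≠ 0).card : ℝ) = nzFrac P m * n.choose m := by
  unfold nzFrac
  have hc : (n.choose m : ℝ) ≠ 0 := by exact_mod_cast (Nat.choose_pos hm).ne'
  rw [div_mul_cancel₀ _ hc]

/-- `|u| ≤ n`. [folklore] -/
theorem wt_le_dim (u : Fin n → Bool) : wt u ≤ n := by
  unfold wt
  exact (card_filter_le _ _).trans (by simp)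

/-- The support is the disjoint union of its layers: `#{u : P u ≠ 0} = Σ_{m ≤ n} N_m`. [folklore] -/
theorem card_filter_ne_zero_eq_sum (P : CubeFn F n) :
    (univ.filter fun u : Fin n → Bool => P u ≠ 0).card =
      ∑ m ∈ range (n + 1), ((layer n m).filter fun u => P u ≠ 0).card := by
  rw [card_eq_sum_card_fiberwise (f := fun u : Fin n → Bool => wt u) (t := range (n + 1))
    (fun u _ => mem_range.2 (Nat.lt_succ_of_le (wt_le_dim u)))]
  refine sum_congr rfl fun m _ => ?_
  unfold layer
  rw [filter_filter, filter_filter]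
  exact congrArg _ (filter_congr fun u _ => by tauto)

/-- `#{u : P u ≠ 0, |u| ≡ r (mod 3)} = Σ_{m ≤ n, m ≡ r (mod 3)} N_m`. [folklore] -/
theorem card_filter_ne_zero_mod_eq_sum (P : CubeFn F n) (r : ℕ) :
    (univ.filter fun u : Fin n → Bool => P u ≠ 0 ∧ wt u % 3 = r % 3).card =
      ∑ m ∈ (range (n + 1)).filter (fun m => m % 3 = r % 3),
        ((layer n m).filter fun u => P u ≠ 0).card := by
  rw [card_eq_sum_card_fiberwise (f := fun u : Fin n → Bool => wt u)
    (t := (range (n + 1)).filter (fun m => m % 3 = r % 3)) ?_]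
  · refine sum_congr rfl fun m hm => ?_
    rw [mem_filter] at hm
    unfold layer
    rw [filter_filter, filter_filter]
    refine congrArg _ (filter_congr fun u _ => ⟨fun h => ⟨h.2, h.1.1⟩, fun h => ⟨⟨h.2, ?_⟩, h.1⟩⟩)
    rw [h.1]; exact hm.2
  · intro u hu
    have hu' := (mem_filter.1 (Finset.mem_coe.1 hu)).2
    exact Finset.mem_coe.2 (mem_filter.2 ⟨mem_range.2 (Nat.lt_succ_of_le (wt_le_dim u)), hu'.2⟩)

/-- `Σ_{m ≤ n} C(n,m) = 2ⁿ` in `ℝ`. [folklore] -/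
theorem sum_range_choose_real (n : ℕ) :
    ∑ m ∈ range (n + 1), (n.choose m : ℝ) = (2 : ℝ) ^ n := by
  exact_mod_cast Nat.sum_range_choose n

end Layers

/-! ### Chebyshev's inequality for the Hamming layers -/

/-- `Σ_{i ≤ n} i(i−1)·C(n,i) = n(n−1)·2ⁿ⁻²` (second factorial moment of the binomial
distribution). [folklore] -/
theorem sum_range_mul_pred_mul_choose (n : ℕ) :
    ∑ i ∈ range (n + 1), i * (i - 1) * n.choose i = n * (n - 1) * 2 ^ (n - 2) := by
  rcases Nat.lt_or_ge n 2 with h | h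
  · interval_cases n <;> simp [sum_range_succ]
  · obtain ⟨m, rfl⟩ : ∃ m, n = m + 2 := ⟨n - 2, by omega⟩
    have key : ∀ i, (i + 1 + 1) * (i + 1 + 1 - 1) * (m + 2).choose (i + 1 + 1) =
        (m + 2) * (m + 1) * m.choose i := by
      intro i
      have h1 := Nat.add_one_mul_choose_eq m i
      have h2 := Nat.add_one_mul_choose_eq (m + 1) (i + 1)
      have e : i + 1 + 1 - 1 = i + 1 := rfl
      rw [e]
      calc (i + 1 + 1) * (i + 1) * (m + 2).choose (i + 1 + 1)
          = ((m + 1 + 1).choose (i + 1 + 1) * (i + 1 + 1)) * (i + 1) := by ring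
        _ = ((m + 1 + 1) * (m + 1).choose (i + 1)) * (i + 1) := by rw [← h2]
        _ = (m + 2) * ((m + 1).choose (i + 1) * (i + 1)) := by ring
        _ = (m + 2) * ((m + 1) * m.choose i) := by rw [← h1]
        _ = (m + 2) * (m + 1) * m.choose i := by ring
    rw [sum_range_succ', sum_range_succ']
    simp only [key]
    rw [← mul_sum, Nat.sum_range_choose]
    simp

/-- `Σ_{i ≤ n} i²·C(n,i) = n(n−1)·2ⁿ⁻² + n·2ⁿ⁻¹`. [folklore] -/
theorem sum_range_sq_mul_choose (n : ℕ) :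
    ∑ i ∈ range (n + 1), i ^ 2 * n.choose i = n * (n - 1) * 2 ^ (n - 2) + n * 2 ^ (n - 1) := by
  have e : ∀ i : ℕ, i ^ 2 * n.choose i = i * (i - 1) * n.choose i + i * n.choose i := by
    intro i
    rcases i with _ | i
    · simp
    · rw [Nat.add_sub_cancel]; ring
  simp only [e, sum_add_distrib, sum_range_mul_pred_mul_choose, Nat.sum_range_mul_choose]

/-- The variance identity `Σ_{m ≤ n} C(n,m)·(2m − n)² = n·2ⁿ`. [folklore] -/
theorem sum_choose_mul_sq (n : ℕ) :
    ∑ m ∈ range (n + 1), (n.choose m : ℝ) * ((2 * m : ℝ) - n) ^ 2 = n * (2 : ℝ) ^ n := by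
  rcases Nat.lt_or_ge n 2 with h | h
  · interval_cases n <;> norm_num [sum_range_succ]
  · obtain ⟨k, rfl⟩ : ∃ k, n = k + 2 := ⟨n - 2, by omega⟩
    have h0 : ∑ m ∈ range (k + 2 + 1), ((k + 2).choose m : ℝ) = (2 : ℝ) ^ (k + 2) :=
      sum_range_choose_real (k + 2)
    have h1 : ∑ m ∈ range (k + 2 + 1), (m : ℝ) * ((k + 2).choose m : ℝ) =
        (k + 2 : ℝ) * (2 : ℝ) ^ (k + 1) := by
      have := Nat.sum_range_mul_choose (k + 2)
      rw [show k + 2 - 1 = k + 1 from rfl] at this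
      exact_mod_cast this
    have h2 : ∑ m ∈ range (k + 2 + 1), (m : ℝ) ^ 2 * ((k + 2).choose m : ℝ) =
        (k + 2 : ℝ) * (k + 1) * (2 : ℝ) ^ k + (k + 2 : ℝ) * (2 : ℝ) ^ (k + 1) := by
      have := sum_range_sq_mul_choose (k + 2)
      rw [show k + 2 - 1 = k + 1 from rfl, show k + 2 - 2 = k from rfl] at this
      exact_mod_cast this
    have e : ∀ m : ℕ, ((k + 2).choose m : ℝ) * ((2 * m : ℝ) - (k + 2 : ℕ)) ^ 2 =
        4 * ((m : ℝ) ^ 2 * ((k + 2).choose m : ℝ)) - 4 * ((k : ℝ) + 2) * ((m : ℝ) * ((k + 2).choose m : ℝ))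
          + ((k : ℝ) + 2) ^ 2 * ((k + 2).choose m : ℝ) := by
      intro m; push_cast; ring
    simp only [e, sum_add_distrib, sum_sub_distrib, ← mul_sum, h0, h1, h2]
    push_cast
    ring

/-- Chebyshev: the layers `m` with `(2m − n)² ≥ T` have total size `≤ n·2ⁿ/T`. [folklore] -/
theorem sum_choose_filter_le_div (n : ℕ) {T : ℝ} (hT : 0 < T) :
    ∑ m ∈ (range (n + 1)).filter (fun m : ℕ => T ≤ (2 * (m : ℝ) - n) ^ 2), (n.choose m : ℝ) ≤
      n * (2 : ℝ) ^ n / T := by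
  rw [le_div_iff₀ hT, sum_mul]
  calc ∑ m ∈ (range (n + 1)).filter (fun m : ℕ => T ≤ (2 * (m : ℝ) - n) ^ 2), (n.choose m : ℝ) * T
      ≤ ∑ m ∈ (range (n + 1)).filter (fun m : ℕ => T ≤ (2 * (m : ℝ) - n) ^ 2),
          (n.choose m : ℝ) * ((2 * m : ℝ) - n) ^ 2 :=
        sum_le_sum fun m hm => mul_le_mul_of_nonneg_left (mem_filter.1 hm).2 (Nat.cast_nonneg _)
    _ ≤ ∑ m ∈ range (n + 1), (n.choose m : ℝ) * ((2 * m : ℝ) - n) ^ 2 :=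
        sum_le_sum_of_subset_of_nonneg (filter_subset _ _) fun m _ _ => by positivity
    _ = n * (2 : ℝ) ^ n := sum_choose_mul_sq n

/-! ### Binomial coefficients near the middle are comparable -/

/-- `C(n, n/2)·(n/2 − s + 1)ᵗ ≤ C(n, n/2 − t)·(n/2 + s + 1)ᵗ` for `t ≤ s ≤ n/2` (each step away
from the middle costs at most the factor `(n/2 + s + 1)/(n/2 − s + 1)`). [folklore] -/
theorem choose_middle_mul_pow_le (n s t : ℕ) (hts : t ≤ s) (hs : s ≤ n / 2) :
    n.choose (n / 2) * (n / 2 - s + 1) ^ t ≤ n.choose (n / 2 - t) * (n / 2 + s + 1) ^ t := by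
  induction t with
  | zero => simp
  | succ t ih =>
    have ih' := ih (Nat.le_of_succ_le hts)
    have hstep := Nat.choose_succ_right_eq n (n / 2 - (t + 1))
    have e1 : n / 2 - (t + 1) + 1 = n / 2 - t := by omega
    rw [e1] at hstep
    calc n.choose (n / 2) * (n / 2 - s + 1) ^ (t + 1)
        = (n.choose (n / 2) * (n / 2 - s + 1) ^ t) * (n / 2 - s + 1) := by ring
      _ ≤ (n.choose (n / 2 - t) * (n / 2 + s + 1) ^ t) * (n / 2 - s + 1) :=
          Nat.mul_le_mul_right _ ih'
      _ ≤ (n.choose (n / 2 - t) * (n / 2 + s + 1) ^ t) * (n / 2 - t) :=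
          Nat.mul_le_mul_left _ (by omega)
      _ = (n.choose (n / 2 - t) * (n / 2 - t)) * (n / 2 + s + 1) ^ t := by ring
      _ = (n.choose (n / 2 - (t + 1)) * (n - (n / 2 - (t + 1)))) * (n / 2 + s + 1) ^ t := by
          rw [hstep]
      _ ≤ (n.choose (n / 2 - (t + 1)) * (n / 2 + s + 1)) * (n / 2 + s + 1) ^ t := by
          apply Nat.mul_le_mul_right
          apply Nat.mul_le_mul_left
          omega
      _ = n.choose (n / 2 - (t + 1)) * (n / 2 + s + 1) ^ (t + 1) := by ring

/-- `e^{-2x} ≤ 1 - x` on `[0, 1/2]`. [folklore] -/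
private theorem exp_neg_two_mul_le_one_sub' {x : ℝ} (h0 : 0 ≤ x) (h1 : x ≤ 1 / 2) :
    Real.exp (-(2 * x)) ≤ 1 - x := by
  have hpos : 0 < 1 - x := by linarith
  have hlog : -(2 * x) ≤ Real.log (1 - x) := by
    have h := Real.log_le_sub_one_of_pos (inv_pos.2 hpos)
    rw [Real.log_inv] at h
    have hinv : (1 - x)⁻¹ ≤ 1 + 2 * x := by
      rw [inv_eq_one_div, div_le_iff₀ hpos]
      nlinarith
    linarith
  calc Real.exp (-(2 * x)) ≤ Real.exp (Real.log (1 - x)) := Real.exp_le_exp.2 hlog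
    _ = 1 - x := Real.exp_log hpos

/-- Near the middle all binomial coefficients are within the factor `e^{8s²/n}` of the largest
one: for `8s ≤ n` and `n/2 − s ≤ k ≤ ⌈n/2⌉ + s`, `C(n, n/2) ≤ e^{8s²/n}·C(n, k)`. [folklore] -/
theorem choose_middle_le_exp_mul_choose {n s k : ℕ} (hsn : 8 * s ≤ n) (hk1 : n / 2 ≤ k + s)
    (hk2 : k ≤ n - n / 2 + s) :
    (n.choose (n / 2) : ℝ) ≤ Real.exp (8 * (s : ℝ) ^ 2 / n) * n.choose k := by
  wlog hk : k ≤ n / 2 generalizing k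
  · have hkn : k ≤ n := by omega
    rw [← Nat.choose_symm hkn]
    exact this (by omega) (by omega) (by omega)
  rcases Nat.eq_zero_or_pos s with rfl | hs
  · have : k = n / 2 := by omega
    subst this
    simp
  -- `t = n/2 - k ≤ s`, the integer inequality, then the exponential bound
  set h := n / 2 with hh
  obtain ⟨t, rfl⟩ : ∃ t, k = h - t := ⟨h - k, by omega⟩
  have hts : t ≤ s := by omega
  have hsh : s ≤ h := by omega
  have hnat := choose_middle_mul_pow_le n s t hts hsh
  rw [← hh] at hnat
  have e : h - (h - t) = t := by omega
  -- real quantities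
  have hnum : (0 : ℝ) < (h : ℝ) - s + 1 := by
    have : (s : ℝ) ≤ h := by exact_mod_cast hsh
    linarith
  have hden : (0 : ℝ) < (h : ℝ) + s + 1 := by positivity
  have hcast : (n.choose h : ℝ) * ((h : ℝ) - s + 1) ^ t ≤ (n.choose (h - t) : ℝ) * ((h : ℝ) + s + 1) ^ t := by
    have := hnat
    have hc : ((h - s + 1 : ℕ) : ℝ) = (h : ℝ) - s + 1 := by push_cast [Nat.cast_sub hsh]; ring
    rw [← hc]
    exact_mod_cast this
  -- `x = 2s/(h+s+1) ∈ [0, 1/2]` and `num = den·(1-x)`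
  set x : ℝ := 2 * s / ((h : ℝ) + s + 1) with hx
  have hx0 : 0 ≤ x := by positivity
  have hx1 : x ≤ 1 / 2 := by
    rw [hx, div_le_iff₀ hden]
    have : (3 : ℝ) * s ≤ h + 1 := by
      have : 3 * s ≤ h + 1 := by omega
      exact_mod_cast this
    linarith
  have hnumeq : (h : ℝ) - s + 1 = ((h : ℝ) + s + 1) * (1 - x) := by
    rw [hx]; field_simp; ring
  -- `(1-x)^s ≥ exp(-2xs)` and `2xs ≤ 8s²/n`
  have hexp1 : Real.exp (-(2 * x * s)) ≤ (1 - x) ^ s := by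
    have h1 := exp_neg_two_mul_le_one_sub' hx0 hx1
    calc Real.exp (-(2 * x * s)) = Real.exp (-(2 * x)) ^ s := by
          rw [← Real.exp_nat_mul]; ring_nf
      _ ≤ (1 - x) ^ s := pow_le_pow_left₀ (Real.exp_nonneg _) h1 s
  have hn0 : (0 : ℝ) < n := by
    have : 0 < n := by omega
    exact_mod_cast this
  have h2xs : 2 * x * s ≤ 8 * (s : ℝ) ^ 2 / n := by
    rw [hx, le_div_iff₀ hn0]
    have hden2 : (n : ℝ) ≤ 2 * ((h : ℝ) + s + 1) := by
      have : n ≤ 2 * (h + s + 1) := by omega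
      exact_mod_cast this
    have : 2 * (2 * (s : ℝ) / ((h : ℝ) + s + 1)) * s * n
        = (4 * (s : ℝ) ^ 2) * (n / ((h : ℝ) + s + 1)) := by ring
    rw [this]
    have hq : (n : ℝ) / ((h : ℝ) + s + 1) ≤ 2 := by
      rw [div_le_iff₀ hden]; linarith
    nlinarith [sq_nonneg (s : ℝ)]
  have h1x : 0 < 1 - x := by linarith
  -- `(1-x)^t ≥ (1-x)^s ≥ exp(-8s²/n)`
  have hpow : Real.exp (-(8 * (s : ℝ) ^ 2 / n)) ≤ (1 - x) ^ t := by
    calc Real.exp (-(8 * (s : ℝ) ^ 2 / n)) ≤ Real.exp (-(2 * x * s)) :=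
          Real.exp_le_exp.2 (by linarith)
      _ ≤ (1 - x) ^ s := hexp1
      _ ≤ (1 - x) ^ t := pow_le_pow_of_le_one h1x.le (by linarith) hts
  -- assemble
  have hdenpow : (0 : ℝ) < ((h : ℝ) + s + 1) ^ t := pow_pos hden t
  rw [hnumeq, mul_pow] at hcast
  -- hcast : C h * (den^t * (1-x)^t) ≤ C (h-t) * den^t
  have hcast' : (n.choose h : ℝ) * (1 - x) ^ t ≤ (n.choose (h - t) : ℝ) := by
    have := hcast
    have : ((n.choose h : ℝ) * (1 - x) ^ t) * ((h : ℝ) + s + 1) ^ t ≤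
        (n.choose (h - t) : ℝ) * ((h : ℝ) + s + 1) ^ t := by linarith
    exact le_of_mul_le_mul_right this hdenpow
  have hE : Real.exp (8 * (s : ℝ) ^ 2 / n) * Real.exp (-(8 * (s : ℝ) ^ 2 / n)) = 1 := by
    rw [← Real.exp_add]; simp
  have hC0 : (0 : ℝ) ≤ (n.choose h : ℝ) := Nat.cast_nonneg _
  calc (n.choose h : ℝ) = (n.choose h : ℝ) * (Real.exp (8 * (s : ℝ) ^ 2 / n) *
        Real.exp (-(8 * (s : ℝ) ^ 2 / n))) := by rw [hE, mul_one]
    _ = Real.exp (8 * (s : ℝ) ^ 2 / n) * ((n.choose h : ℝ) * Real.exp (-(8 * (s : ℝ) ^ 2 / n))) := by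
        ring
    _ ≤ Real.exp (8 * (s : ℝ) ^ 2 / n) * ((n.choose h : ℝ) * (1 - x) ^ t) := by
        gcongr
    _ ≤ Real.exp (8 * (s : ℝ) ^ 2 / n) * (n.choose (h - t) : ℝ) := by
        gcongr

/-- Consequence: every binomial coefficient `C(n, m)` is at most `e^{8s²/n}·C(n, k)` for `k` within
`s` of the middle (`8s ≤ n`). [folklore] -/
theorem choose_le_exp_mul_choose {n s k : ℕ} (hsn : 8 * s ≤ n) (hk1 : n / 2 ≤ k + s)
    (hk2 : k ≤ n - n / 2 + s) (m : ℕ) :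
    (n.choose m : ℝ) ≤ Real.exp (8 * (s : ℝ) ^ 2 / n) * n.choose k :=
  le_trans (by exact_mod_cast Nat.choose_le_middle m n) (choose_middle_le_exp_mul_choose hsn hk1 hk2)

/-! ### Small arithmetic facts -/

/-- A power of two in `(m, 2m]`. [folklore] -/
theorem exists_pow_two_btwn (m : ℕ) (hm : 0 < m) : ∃ j : ℕ, m < 2 ^ j ∧ 2 ^ j ≤ 2 * m := by
  refine ⟨Nat.log 2 m + 1, Nat.lt_pow_succ_log_self (by norm_num) m, ?_⟩
  have := Nat.pow_log_le_self 2 hm.ne'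
  rw [pow_succ]
  omega

/-- Powers of two are never divisible by three. [folklore] -/
theorem two_pow_mod_three_ne_zero (j : ℕ) : 2 ^ j % 3 ≠ 0 := by
  induction j with
  | zero => norm_num
  | succ j ih => rw [pow_succ]; omega

/-- `α(n,k) ≤ 1/2`. [cite: Srinivasan2023, Lemma 3.1 (α = min{k/n, 1 − k/n})] -/
theorem alphaOf_le_half (n k : ℕ) : alphaOf n k ≤ 1 / 2 := by
  unfold alphaOf
  rcases le_total ((k : ℝ) / n) (1 / 2) with h | h
  · exact (min_le_left _ _).trans h
  · exact (min_le_right _ _).trans (by linarith)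

/-- `α(n,k) ≥ 1/4` for `n/4 ≤ k ≤ 3n/4`. [cite: Srinivasan2023, Lemma 3.1 (α = min{k/n, 1 − k/n})] -/
theorem quarter_le_alphaOf {n k : ℕ} (hn : 0 < n) (h1 : n ≤ 4 * k) (h2 : 4 * k ≤ 3 * n) :
    1 / 4 ≤ alphaOf n k := by
  unfold alphaOf
  have hn' : (0 : ℝ) < n := by exact_mod_cast hn
  have h1' : (n : ℝ) ≤ 4 * k := by exact_mod_cast h1
  have h2' : (4 * k : ℝ) ≤ 3 * n := by exact_mod_cast h2
  apply le_min
  · rw [le_div_iff₀ hn']; linarith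
  · have : (k : ℝ) / n ≤ 3 / 4 := by rw [div_le_iff₀ hn']; linarith
    linarith

end Summit.QuantumAdvantage.AdviceFreeQNC0
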